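import Mathlib.Algebra.Group.Basic
import Mathlib.Algebra.Module.Defs
import Mathlib.Tactic.Abel
import Mathlib.Tactic.NormNum
import Mathlib.Tactic.Module
import Mathlib.Tactic.LinearCombination
import HarnessLib

/-!
# The `s = 1` wall of the Prym–Torelli census — kernel skeleton (WEIL-2 gen 48, WALL-G48, fact-free)

research route, not a corollary; conditional on HC_CM plus one named minimal statement.

Cell `pub-hodge-ring2-ab-*` (ALL ABELIAN VARIETIES), seat WEIL-2 gen 48, account
`run/shared/lean/pub/pub-hodge-ring2/pub-hodge-ring2-ab-weil-2/WALL-G48.md`.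

Informal setting.  After gen 47 exactly 17 positive-dimensional non-split Galois–Prym data (`n ≤ 4`) had a proof of
immersion of the `K`-piece period map only at the GENERAL member of their (unique) component — the `s = 1` wall:
#4 `[x³s7,x¹s7]` (f = 24) and #6 `[x³s19,x¹s19]` (f = 30) over an elliptic base, the twelve `f = 12 / E` data, and the
three Klein data at `f = 24 / ℙ¹`.  WALL-G48 proves immersion at EVERY member for all 17 by one criterion — the
SECANT–JET CRITERION: a deficient member carries a functional `λ ≠ 0` on `T = H⁰(2K'+B')^H ≅ H⁰(Y, ω_Y²(Δ))` supported
on a divisor `Z` of the base `Y` with `deg Z ≤ ⌈dim T/2⌉` (secant varieties of curves are non-defective); reading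
`λ ∘ Tr_H ∘ μ` through the jets of `C'` along the divisor `Z_λ` (`N_λ := deg Z_λ`) gives a non-degenerate pairing, whence
`h⁰(K'+D₀−Z_λ) + h⁰(K'+B'−D₀−Z_λ) ≥ 2g' − N_λ` — and three closing arguments: NORM (#4, #6, the `h = 5` bielliptic data),
TWO-TORSION (the `h = 7` bielliptic data) and the LINE LEMMA (the Klein data, read over the elliptic curve `E_τ = C'/τ`).

This file holds the finite bookkeeping behind those arguments: the count `N_λ = 2k − m ≤ 2g' − 2`, the two-point shape,
the Clifford / Accola / Castelnuovo–Severi numerics excluding the intermediate cases, and — as identities in an arbitrary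
additive commutative group standing for the divisor class group — the eliminations for #6 and #4, the norm step, the
`h = 5` and `h = 7` torsion steps, the Klein two-point identity `σp'' + τp ∼ 2p` and the Klein line identity
`2p + σp ∼ w + w' + τp`.

0 sorry, no `def`, no named fact; `HC_CM` does not occur.
-/

namespace Summit.HodgeConjecture.Ring2AbelianAll.PrymTorelliWall

section counting

/-- WALL-G48 §1.4 (the count).  A functional supported on a divisor `Z` of the base with `k = deg Z ≤ g' − 1` points, `m ≤ k`
of them unmarked branch points, has jet divisor `Z_λ ⊂ C'` of degree `N = 2k − m`; so `N ≤ 2g' − 2` with equality iff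
`k = g' − 1` and `m = 0` (the «two-point» case, where `deg(K' + D₀ − Z_λ) = 2g' − 1 − N = 1`).
research route, not a corollary; conditional on HC_CM plus one named minimal statement. -/
theorem secant_count (g k m : ℕ) (hg : 3 ≤ g) (hk : k ≤ g - 1) (hm : m ≤ k) :
    2 * k - m ≤ 2 * g - 2 ∧ (2 * k - m = 2 * g - 2 ↔ (k = g - 1 ∧ m = 0)) ∧
    (2 * k - m = 2 * g - 2 → 2 * g - 1 - (2 * k - m) = 1) := by
  refine ⟨by omega, ⟨fun h => by omega, fun h => by omega⟩, fun h => by omega⟩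

/-- WALL-G48 §1.5 (the two-point shape).  Two degree-`1` classes on a curve of positive genus with `h⁰ + h⁰ ≥ 2`
(each `h⁰ ≤ 1`) are both effective; dually (`N_λ = 2`) the same for `Z_λ − D₀` and `Z_λ + D₀ − B'`.
research route, not a corollary; conditional on HC_CM plus one named minimal statement. -/
theorem two_point_shape (a b : ℕ) (ha : a ≤ 1) (hb : b ≤ 1) (hab : 2 ≤ a + b) : a = 1 ∧ b = 1 := by omega

/-- WALL-G48 §3.3 / §4.4 (Clifford bookkeeping, non-hyperelliptic genus `4`): `h⁰ ≤ 1` in degree `2` and `h⁰ ≤ 2` in degrees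
`3, 4` make `h⁰ + h⁰ ≥ N` (both of degree `N − 1`) impossible for `N = 3, 5` and force two pencils `g¹₃` for `N = 4`.
Genus `5` (the `n = 5` bielliptic data, `r_H = 8`): with `h⁰ ≤ 1, 1, 2, 2, 3, 3` in degrees `2,…,7` every `N ∈ {3,…,7}` fails
except through `g¹₃, g²₄, g²₅, g³₆`, absent by Castelnuovo–Severi (a bielliptic curve of genus `≥ 5` is not trigonal:
`g ≤ (2−1)(3−1) + 2·1 + 3·0 = 4`) and Clifford.  research route, not a corollary; conditional on HC_CM plus one named
minimal statement. -/
theorem clifford_bookkeeping :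
    (∀ a b : ℕ, a ≤ 1 → b ≤ 1 → ¬ 3 ≤ a + b) ∧ (∀ a b : ℕ, a ≤ 2 → b ≤ 2 → ¬ 5 ≤ a + b) ∧
    (∀ a b : ℕ, a ≤ 2 → b ≤ 2 → 4 ≤ a + b → (a = 2 ∧ b = 2)) ∧
    (∀ a b : ℕ, a ≤ 2 → b ≤ 2 → ¬ 6 ≤ a + b) ∧ (∀ a b : ℕ, a ≤ 3 → b ≤ 3 → 7 ≤ a + b → 4 ≤ a ∨ 4 ≤ b) ∧
    ((2 - 1) * (3 - 1) + 2 * 1 + 3 * 0 = (4 : ℕ) ∧ (4 : ℕ) < 5) := by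
  refine ⟨fun a b ha hb => by omega, fun a b ha hb => by omega, fun a b ha hb h => by omega,
    fun a b ha hb => by omega, fun a b ha hb h => by omega, by norm_num, by norm_num⟩

/-- WALL-G48 §3.1 / §4.1 (no hyperelliptic members in genus `4` and `5`).  A hyperelliptic curve with an involution of
elliptic quotient would have, by Accola's count for a `C₂ × C₂` with rational quotient, `g = 1 + 0 + g₃`, and then
Riemann–Hurwitz for the third involution needs a NEGATIVE number `2g − 2 − 2(2g₃ − 2)` of fixed points when `g ∈ {4, 5}`;
equivalently the bidouble type `(|S|,|T|,|U|)` with quotient genera `(1, 0, g − 1)` has no solution for `g = 4`, while for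
`g = 3` the unique solution is `(2,4,0)` (the hyperelliptic members of the genus-3 families).
research route, not a corollary; conditional on HC_CM plus one named minimal statement. -/
theorem accola_no_hyperelliptic :
    (∀ g₃ : ℤ, (4 : ℤ) = 1 + 0 + g₃ → 2 * 4 - 2 - 2 * (2 * g₃ - 2) < 0) ∧
    (∀ g₃ : ℤ, (5 : ℤ) = 1 + 0 + g₃ → 2 * 5 - 2 - 2 * (2 * g₃ - 2) < 0) ∧
    (¬ ∃ S T U : ℕ, T + U = 4 ∧ S + U = 2 ∧ S + T = 8) ∧
    (∀ S T U : ℕ, (T + U = 4 ∧ S + U = 2 ∧ S + T = 6) ↔ (S = 2 ∧ T = 4 ∧ U = 0)) := by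
  refine ⟨fun g₃ h => by omega, fun g₃ h => by omega, fun ⟨S, T, U, h1, h2, h3⟩ => by omega, fun S T U => by omega⟩

end counting

section classgroup

variable {A : Type*} [AddCommGroup A]

/-- WALL-G48 §2.1 (the norm step for #4 and #6).  Let `ε := π_*D₀ − y₁` in `Pic(E)`.  For #6 (`f = 30`, `h = 17`) the
push-forwards of (E1) and (E_α) give `30ε ∼ 0` and `16ε ∼ 0`; for #4 (`f = 24`) they give `24ε ∼ 0`, `6ε ∼ 0`, `4ε ∼ 0`.
Either way `2ε ∼ 0`, so `π_*(B' − 2D₀) = −2ε ∼ 0` and the two points `p, p''` with `p'' − p ∼ B' − 2D₀` lie in one fibre.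
research route, not a corollary; conditional on HC_CM plus one named minimal statement. -/
theorem norm_two_torsion (ε : A) :
    ((30 : ℤ) • ε = 0 → (16 : ℤ) • ε = 0 → (2 : ℤ) • ε = 0) ∧
    ((24 : ℤ) • ε = 0 → (6 : ℤ) • ε = 0 → (4 : ℤ) • ε = 0 → (2 : ℤ) • ε = 0) := by
  refine ⟨fun h30 h16 => ?_, fun h24 h6 h4 => ?_⟩
  · linear_combination (norm := module) (2 : ℤ) • h16 - h30
  · linear_combination (norm := module) h6 - h4

/-- WALL-G48 §2.2, datum #6 (`f = 30`, `h = 17`, `B' = w + w'`, `δ = 20w + 10w'`; `T'₁₇ = −11w − 5w'`, `T'₁₉ = −12w − 6w'`,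
`T'₂₃ = −15w − 7w'`).  With `X := 3D₀ − 2w − w'`: (E1) is `10X ∼ 0`, «no fifth root» is `2X ≁ 0`, and the three candidate
relations `α^{*j}D₀ + D₀ ∼ B'` (`α^{*j}D₀ ∼ h_jD₀ + T'_{h_j}`) read `18D₀ ∼ 12w + 6w'` (`= 6X ∼ 0`), `20D₀ ∼ 13w + 7w'`,
`24D₀ ∼ 16w + 8w'` (`= 8X ∼ 0`).  The first and third force `2X ∼ 0`; the second forces `w ∼ w'` (distinct points of a
non-rational curve): all three are absurd.  research route, not a corollary; conditional on HC_CM plus one named minimal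
statement. -/
theorem datum6_eliminations (D w w' : A) :
    ((18 : ℤ) • D - ((12 : ℤ) • w + (6 : ℤ) • w') = (6 : ℤ) • ((3 : ℤ) • D - (2 : ℤ) • w - w') ∧
     (24 : ℤ) • D - ((16 : ℤ) • w + (8 : ℤ) • w') = (8 : ℤ) • ((3 : ℤ) • D - (2 : ℤ) • w - w') ∧
     (30 : ℤ) • D - ((20 : ℤ) • w + (10 : ℤ) • w') = (10 : ℤ) • ((3 : ℤ) • D - (2 : ℤ) • w - w') ∧
     ((4 : ℤ) • w + (2 : ℤ) • w') - (6 : ℤ) • D = -((2 : ℤ) • ((3 : ℤ) • D - (2 : ℤ) • w - w'))) ∧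
    (∀ X : A, (10 : ℤ) • X = 0 → (6 : ℤ) • X = 0 → (2 : ℤ) • X = 0) ∧
    (∀ X : A, (10 : ℤ) • X = 0 → (8 : ℤ) • X = 0 → (2 : ℤ) • X = 0) ∧
    ((30 : ℤ) • D = (20 : ℤ) • w + (10 : ℤ) • w' → (20 : ℤ) • D = (13 : ℤ) • w + (7 : ℤ) • w' → w = w') := by
  refine ⟨⟨by module, by module, by module, by module⟩, fun X h10 h6 => ?_, fun X h10 h8 => ?_, fun h30 h20 => ?_⟩
  · linear_combination (norm := module) (2 : ℤ) • h6 - h10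
  · linear_combination (norm := module) h10 - h8
  · linear_combination (norm := module) (3 : ℤ) • h20 - (2 : ℤ) • h30

/-- WALL-G48 §2.2, datum #4 (`f = 24`, `H = {1,5,7,11}`, `B' = w + w'`, `δ = 8w + 16w'`; class conditions
`τ^*D₀ ∼ 7D₀ − 2w − 4w'`, `σ^*D₀ ∼ 5D₀ − w − 3w'`, `(στ)^*D₀ ∼ 11D₀ − 3w − 7w'`, `24D₀ ∼ δ`, connected iff
`12D₀ ≁ 4w + 8w'`).  The three candidate relations `g^*D₀ + D₀ ∼ B'` become `8D₀ ∼ 3w + 5w'` (with (E1): `w ∼ w'`),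
`6D₀ ∼ 2w + 4w'` (doubling: `F` a square) and `12D₀ ∼ 4w + 8w'` (`F` a square): all absurd.
research route, not a corollary; conditional on HC_CM plus one named minimal statement. -/
theorem datum4_eliminations (D w w' τD σD στD : A) (hτ : τD = (7 : ℤ) • D - (2 : ℤ) • w - (4 : ℤ) • w')
    (hσ : σD = (5 : ℤ) • D - w - (3 : ℤ) • w') (hστ : στD = (11 : ℤ) • D - (3 : ℤ) • w - (7 : ℤ) • w') :
    (τD + D = w + w' → (8 : ℤ) • D = (3 : ℤ) • w + (5 : ℤ) • w') ∧
    (σD + D = w + w' → (6 : ℤ) • D = (2 : ℤ) • w + (4 : ℤ) • w') ∧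
    (στD + D = w + w' → (12 : ℤ) • D = (4 : ℤ) • w + (8 : ℤ) • w') ∧
    ((24 : ℤ) • D = (8 : ℤ) • w + (16 : ℤ) • w' → (8 : ℤ) • D = (3 : ℤ) • w + (5 : ℤ) • w' → w = w') ∧
    ((6 : ℤ) • D = (2 : ℤ) • w + (4 : ℤ) • w' → (12 : ℤ) • D = (4 : ℤ) • w + (8 : ℤ) • w') := by
  refine ⟨fun h => ?_, fun h => ?_, fun h => ?_, fun h24 h8 => ?_, fun h6 => ?_⟩
  · linear_combination (norm := module) h - hτ
  · linear_combination (norm := module) h - hσ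
  · linear_combination (norm := module) h - hστ
  · linear_combination (norm := module) h24 - (3 : ℤ) • h8
  · linear_combination (norm := module) (2 : ℤ) • h6

/-- WALL-G48 §3.2, the `f = 12 / E` data with `h = 5` (ℚ(i); `δ = 6w + 6w'`, `T' = −2w − 2w'`).  With `d := B' − 2D₀ =
w + w' − 2D₀`: (E1) is `6d ∼ 0`, «no cube» is `2d ≁ 0`, «no square» is `3d ≁ 0`, and `c := ι^*D₀ − D₀ ∼ −2d`.  NORM:
`ι^*D₀ + D₀ = π^*π_*D₀ ∼ 6D₀ − 2w − 2w'` and `12D₀ ∼ 6w + 6w'` give `π^*(2π_*D₀) ∼ π^*(b̄ + b̄')`, so (π^* injective)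
`π_*d ∼ 0`: the two points lie in one fibre, `p'' = ιp`, and then `d ∼ c = −2d`, i.e. `3d ∼ 0` — a square.  Here the
identities.  research route, not a corollary; conditional on HC_CM plus one named minimal statement. -/
theorem biell_h5_eliminations (D w w' ιD : A) (hι : ιD = (5 : ℤ) • D - (2 : ℤ) • w - (2 : ℤ) • w') :
    (ιD - D = -((2 : ℤ) • (w + w' - (2 : ℤ) • D))) ∧
    ((12 : ℤ) • D - ((6 : ℤ) • w + (6 : ℤ) • w') = -((6 : ℤ) • (w + w' - (2 : ℤ) • D))) ∧
    (ιD + D + ((2 : ℤ) • w + (2 : ℤ) • w') = (6 : ℤ) • D) ∧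
    (∀ d : A, d = -((2 : ℤ) • d) → (3 : ℤ) • d = 0) ∧
    (∀ d : A, (6 : ℤ) • d = 0 → (3 : ℤ) • d = 0 → (2 : ℤ) • d = 0 → d = 0) := by
  refine ⟨?_, by module, ?_, fun d h => ?_, fun d h6 h3 h2 => ?_⟩
  · linear_combination (norm := module) hι
  · linear_combination (norm := module) hι
  · linear_combination (norm := module) h
  · linear_combination (norm := module) h3 - h2

/-- WALL-G48 §3.2, the `f = 12 / E` data with `h = 7` (ℚ(√−3); `δ = 4w + 8w'`, `T' = −2w − 4w'`).  With
`u := w + 2w' − 3D₀`: (E1) is `4u ∼ 0`, «no square» is `2u ≁ 0`, `c := ι^*D₀ − D₀ ∼ −2u` has exact order `2`, and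
`3d ∼ 2u + (w − w')` for `d = w + w' − 2D₀`.  TWO-TORSION: `ιp − p ∼ c` forces `2p ∼ 2ιp`, `p ≠ ιp` — a `g¹₂` with `p, ιp`
Weierstrass; likewise for `p''`; then `p'' ∈ {p, ιp}`: `d ∼ 0` gives `2(w' − w) ∼ 4u ∼ 0`, i.e. `b̄ = b̄'`; `d ∼ c` gives
`w − w' ∼ −8u ∼ 0`.  Here the identities.  research route, not a corollary; conditional on HC_CM plus one named minimal
statement. -/
theorem biell_h7_eliminations (D w w' ιD : A) (hι : ιD = (7 : ℤ) • D - (2 : ℤ) • w - (4 : ℤ) • w') :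
    (ιD - D = -((2 : ℤ) • (w + (2 : ℤ) • w' - (3 : ℤ) • D))) ∧
    (((4 : ℤ) • w + (8 : ℤ) • w') - (12 : ℤ) • D = (4 : ℤ) • (w + (2 : ℤ) • w' - (3 : ℤ) • D)) ∧
    ((3 : ℤ) • (w + w' - (2 : ℤ) • D) = (2 : ℤ) • (w + (2 : ℤ) • w' - (3 : ℤ) • D) + (w - w')) ∧
    (∀ u : A, w + w' - (2 : ℤ) • D = 0 → u = w + (2 : ℤ) • w' - (3 : ℤ) • D → (4 : ℤ) • u = 0 →
        (2 : ℤ) • (w' - w) = 0) ∧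
    (∀ u : A, w + w' - (2 : ℤ) • D = -((2 : ℤ) • u) → u = w + (2 : ℤ) • w' - (3 : ℤ) • D → (4 : ℤ) • u = 0 →
        w - w' = 0) := by
  refine ⟨?_, by module, by module, fun u hd hu h4 => ?_, fun u hd hu h4 => ?_⟩
  · linear_combination (norm := module) hι
  · linear_combination (norm := module) h4 - (4 : ℤ) • hu - (6 : ℤ) • hd
  · linear_combination (norm := module) (3 : ℤ) • hd + (2 : ℤ) • hu - (2 : ℤ) • h4

/-- WALL-G48 §3.2 (two Weierstrass points differ by `2`-torsion; a class of exact order `4` is not such a difference):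
if `2p ∼ G ∼ 2q` then `2(q − p) ∼ 0`; and `8u ∼ 0`, `2u ≁ 0`-type bookkeeping: `2u ∼ 0 → 4u ∼ 0`.
research route, not a corollary; conditional on HC_CM plus one named minimal statement. -/
theorem weierstrass_difference (p q G u : A) :
    ((2 : ℤ) • p = G → (2 : ℤ) • q = G → (2 : ℤ) • (q - p) = 0) ∧ ((2 : ℤ) • u = 0 → (4 : ℤ) • u = 0) := by
  refine ⟨fun hp hq => ?_, fun h2 => ?_⟩
  · linear_combination (norm := module) hq - hp
  · linear_combination (norm := module) (2 : ℤ) • h2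

/-- WALL-G48 §4.3 (the Klein two-point identity for an `H`-invariant `Z_λ`).  With the Klein class conditions
`τ^*D₀ ∼ 7D₀ − 2w − 4w'`, `σ^*D₀ ∼ 5D₀ − w − 3w'` (`c_g := g^*D₀ − D₀`, `d := B' − 2D₀`, so `d − c_σ = 2u`, `c_τ = −2u`,
`u = w + 2w' − 3D₀`): if `p'' ∼ p + d`, `σp'' ∼ p'' − c_σ`, `τp ∼ p + c_τ` (the ties of an `H`-invariant `Z_λ`), then
`σp'' + τp ∼ 2p`.  On a curve of genus `≥ 2` this forces `τp = p` (so `c_τ ∼ 0`, `2u ∼ 0`) unless `p, τp` are Weierstrass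
points of a hyperelliptic member (then `4u ∼ 0`): both against connectedness (`4u ≁ 0`).
research route, not a corollary; conditional on HC_CM plus one named minimal statement. -/
theorem klein_two_point (D w w' p p'' σp'' τp : A)
    (hp'' : p'' = p + (w + w' - (2 : ℤ) • D)) (hσ : σp'' = p'' - ((4 : ℤ) • D - w - (3 : ℤ) • w'))
    (hτ : τp = p + ((6 : ℤ) • D - (2 : ℤ) • w - (4 : ℤ) • w')) : σp'' + τp = (2 : ℤ) • p := by
  linear_combination (norm := module) hσ + hp'' + hτ

/-- WALL-G48 §4.5 LEMMA L (the line identity for the Klein data).  Hypotheses, all in the class group of `C'`: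
`p + φ^*ζ ∼ K' + D₀` (the effective degree-one class of the two-point case over `E_τ`), its `σ`- and `τ`-translates
`σp + φ^*(σ̄ζ) ∼ K' + σ^*D₀`, `τp + φ^*ζ ∼ K' + τ^*D₀`, the Klein class conditions for `σ^*D₀`, `τ^*D₀`, and the two
facts `φ^*(ζ + σ̄ζ) ∼ (g'−1)D_∞ ∼ 2K'` (every `σ̄`-orbit of `E_τ` is a fibre over `ℙ¹`; `2K' ∼ (r − 4)D_∞`).  Conclusion:
`2p + σp ∼ w + w' + τp` — three collinear points `w, w', τp` on the canonical curve (or `p ∈ {w, w'}`), which §4.5 rules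
out with the `τ`-stable line through `w, w'`.
research route, not a corollary; conditional on HC_CM plus one named minimal statement. -/
theorem klein_line_identity (D w w' K E p σp τp φZ φZ' σD τD : A)
    (hτ : τD = (7 : ℤ) • D - (2 : ℤ) • w - (4 : ℤ) • w') (hσ : σD = (5 : ℤ) • D - w - (3 : ℤ) • w')
    (h2K : (2 : ℤ) • K = E) (hZ : φZ + φZ' = E)
    (hp : p + φZ = K + D) (hσp : σp + φZ' = K + σD) (hτp : τp + φZ = K + τD) :
    (p + σp = (w + w') - (2 : ℤ) • (w + (2 : ℤ) • w' - (3 : ℤ) • D)) ∧ (τp - p = -((2 : ℤ) • (w + (2 : ℤ) • w' - (3 : ℤ) • D))) ∧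
    ((2 : ℤ) • p + σp = w + w' + τp) := by
  refine ⟨?_, ?_, ?_⟩
  · linear_combination (norm := module) hp + hσp - hZ + h2K + hσ
  · linear_combination (norm := module) hτp - hp + hτ
  · linear_combination (norm := module) (2 : ℤ) • hp + hσp - hτp - hZ + h2K + hσ - hτ

/-- WALL-G48 §4.5 (the divisor-equality branch of LEMMA L and the collinear branch, as multiset bookkeeping on labels):
if the multisets `{p, p, σp}` and `{w, w', τp}` agree with `w ≠ w'`, then `p ∈ {w, w'}` and `τp = p`; encoded for labels in
`ℕ` (any decidable type would do).  research route, not a corollary; conditional on HC_CM plus one named minimal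
statement. -/
theorem line_multiset_branch (p σp w w' τp : ℕ) (hww : w ≠ w')
    (h : ({p, p, σp} : Multiset ℕ) = {w, w', τp}) : (p = w ∨ p = w') ∧ τp = p := by
  have hc : Multiset.count p ({p, p, σp} : Multiset ℕ) = Multiset.count p ({w, w', τp} : Multiset ℕ) := by rw [h]
  simp only [Multiset.insert_eq_cons, Multiset.count_cons, Multiset.count_singleton] at hc
  constructor <;> split_ifs at hc <;> omega

end classgroup

end Summit.HodgeConjecture.Ring2AbelianAll.PrymTorelliWall
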